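import Mathlib
import HarnessLib
import Summits.NavierStokesRegularity.NavierStokesRegularity.Theses.AxisTwistDoor
import Summits.NavierStokesRegularity.NavierStokesRegularity.Theorems.AxisTwistDoorTiltDominationLocDefs
import Summits.NavierStokesRegularity.NavierStokesRegularity.Theorems.AxisTwistDoorTiltDominationLocRigidity
import Summits.NavierStokesRegularity.NavierStokesRegularity.Theorems.AxisTwistDoorTiltDominationLocEnergyClass
import Summits.NavierStokesRegularity.NavierStokesRegularity.Theorems.AxisTwistDoorTiltDominationLocNeckLength
import Summits.NavierStokesRegularity.NavierStokesRegularity.Theorems.AxisTwistDoorAveragedConeLiouvilleHolds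
import Summits.NavierStokesRegularity.NavierStokesRegularity.Theorems.AxisTwistDoorScalingToUnit
import Summits.NavierStokesRegularity.NavierStokesRegularity.Theorems.FilamentPinchDoorFilamentaryGrowth

/-!
# AxisTwistDoor · crux `TiltDominationLoc` (stmt-NavierStokesRegularity-26991) — PORTRAIT OF THE HYPOTHETICAL COUNTEREXAMPLE
# (typed obstructions for the «negation» lens of KEY-NS #148: what a one-signed backward-singular Type-I profile must look like)

By `…EnergyClass.oneSignedRigidity_iff_core` the crux is «no Type-I ancient Oseen-mild profile with `ω₃ ≥ 0` is backward-singular at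
the apex».  A counterexample is therefore a field `v` with ONLY: Type-I rate, continuity on the open slab, the unit-viscosity Oseen
identity, divergence-free slices, `⟪curl v(s), e₃⟫ ≥ 0`, and a backward-singular apex.  This file lists, as ONE kernel theorem, what
the tree then forces on it — every clause a landed theorem, so a «negation» card (ideator ns-idea-15) can cite the obstruction it tests:

* `portrait` — (i) the energy class is automatic (pressure, weak gradient, `𝐈 < ∞`: `exists_energyClass_of_typeI`); (ii) linear
  `e₃`-ball growth of `ω₃` (`axisTwistDoor_filamentaryGrowth_proof`, item 26431); (iii) the neck bound (`neckLength`, stub 1); (iv) it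
  TWISTS AT ALL SCALES: on NO parabolic neighbourhood of the apex is it tilt-dominated — for every `δ > 0`, `K, M ≥ 0` some axis circle
  of the `δ`-collar has `∮|ω_h| dl > K ∮ω₃ dl + M r` (contrapositive of `ScalingToUnit ∘ AveragedConeLiouville`, both PROVED);
* `counterexample_dichotomy` — it refutes `PoloidalRigidity` (wall W4, if `ω₃ ≡ 0`) or `SingularIsPoloidal` (wall W6 ≡ W5, if
  `ω₃ ≢ 0`; then also every parabolic neighbourhood of the apex contains an axis circle with positive `ω₃`-flux, by
  `…Rigidity.nonPlanarApex_of_not_poloidal`).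

WHAT THIS IS NOT: no such profile is known or constructed here; nothing is proved about Navier–Stokes regularity (Clay A OPEN); the
crux 26991 and the walls 19708 / 25311 ≡ 26430 are OPEN.  Seat ns-atd-p1 (LEAD g3).  [cite: arXiv:2501.08976, Rem. 1.3]
-/

noncomputable section

-- the summit and its single sub-problem share the name (CONVENTIONS §1), as in every Theorems file
set_option linter.dupNamespace false

namespace Summit.NavierStokesRegularity.NavierStokesRegularity.Theorems.AxisTwistDoorTiltDominationLocCounterexamplePortrait

open Set Function Filter Topology MeasureTheory Metric
open scoped ENNReal InnerProductSpace
open Literature.Analysis Literature.Analysis.FluidPDE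
open Summit.NavierStokesRegularity.NavierStokesRegularity.Theses.AxisTwistDoor
open Summit.NavierStokesRegularity.NavierStokesRegularity.Theorems.AxisTwistDoorTiltDominationLocDefs
open Summit.NavierStokesRegularity.NavierStokesRegularity.Theorems.AxisTwistDoorTiltDominationLocRigidity
open Summit.NavierStokesRegularity.NavierStokesRegularity.Theorems.AxisTwistDoorTiltDominationLocEnergyClass

variable {C : ℝ} {v : ℝ → EuclideanSpace ℝ (Fin 3) → EuclideanSpace ℝ (Fin 3)}

/-- **PORTRAIT OF THE COUNTEREXAMPLE.**  A Type-I ancient Oseen-mild profile with `ω₃ ≥ 0` everywhere and a backward-singular apex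
(the negation of the crux in core form) necessarily: (i) belongs to the energy class with some pressure `π` and weak gradient `H`;
(ii) has linear `e₃`-ball growth of `ω₃`; (iii) satisfies the neck bound; (iv) is tilt-dominated about the apex axis on NO parabolic
neighbourhood of the apex — for all `δ > 0`, `K ≥ 0`, `M ≥ 0` some axis circle `S(r,z)`, `−δ² < s < 0`, `0 < r < δ`, `|z| < δ`, carries
`∮|ω_h| r dθ > K ∮ω₃ r dθ + M r`. -/
theorem portrait (hrate : HasTypeITimeDecay C v)
    (hcont : ContinuousOn (uncurry v) (Iio (0 : ℝ) ×ˢ univ))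
    (hmild : ∀ s t : ℝ, s < t → t < 0 → ∀ x,
      v t x = UnboundedOperators.heatExtension (v s) (t - s) x - oseenDuhamel 1 s v v t x)
    (hdiv : ∀ t < 0, VectorCalculus.IsDivFree (v t))
    (hnn : ∀ s < 0, ∀ y, 0 ≤ ⟪curl (v s) y, (EuclideanSpace.single (2 : Fin 3) (1 : ℝ))⟫_ℝ)
    (hsing : IsBackwardSingularPoint v 0) :
    (∃ (π : ℝ → EuclideanSpace ℝ (Fin 3) → ℝ)
        (H : ℝ → EuclideanSpace ℝ (Fin 3) → EuclideanSpace ℝ (Fin 3) →L[ℝ] EuclideanSpace ℝ (Fin 3)),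
        IsSuitableWeakSolutionOn (slab (EuclideanSpace ℝ (Fin 3)) (Iio (0 : ℝ)) isOpen_Iio) 1 0 v π ∧
        HasWeakSpatialGradientOn (slab (EuclideanSpace ℝ (Fin 3)) (Iio (0 : ℝ)) isOpen_Iio) v H ∧
        typeIBound (Iio (0 : ℝ) ×ˢ univ) v π H < ⊤) ∧
    (∃ K : ℝ, ∀ s < 0, ∀ (x : EuclideanSpace ℝ (Fin 3)) (R : ℝ), 0 < R →
        ∫⁻ y in ball x R, ENNReal.ofReal ⟪curl (v s) y, (EuclideanSpace.single (2 : Fin 3) (1 : ℝ))⟫_ℝ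
          ≤ ENNReal.ofReal (K * R)) ∧
    NeckBound v ∧
    (∀ δ K M : ℝ, 0 < δ → 0 ≤ K → 0 ≤ M → ∃ s r z : ℝ, -δ ^ 2 < s ∧ s < 0 ∧ 0 < r ∧ r < δ ∧ |z| < δ ∧
        K * (∫ θ in (0 : ℝ)..(2 * Real.pi), ⟪curl (v s)
            (WithLp.toLp 2 ![r * Real.cos θ, r * Real.sin θ, z] : EuclideanSpace ℝ (Fin 3)),
            (EuclideanSpace.single (2 : Fin 3) (1 : ℝ))⟫_ℝ * r) + M * r <
          ∫ θ in (0 : ℝ)..(2 * Real.pi), ‖curl (v s)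
            (WithLp.toLp 2 ![r * Real.cos θ, r * Real.sin θ, z] : EuclideanSpace ℝ (Fin 3)) -
            ⟪curl (v s) (WithLp.toLp 2 ![r * Real.cos θ, r * Real.sin θ, z] : EuclideanSpace ℝ (Fin 3)),
              (EuclideanSpace.single (2 : Fin 3) (1 : ℝ))⟫_ℝ • (EuclideanSpace.single (2 : Fin 3) (1 : ℝ))‖ * r) := by
  obtain ⟨π, H, hsw, hwg, hI⟩ := exists_energyClass_of_typeI hrate hcont hmild hdiv
  have hK : ∃ K : ℝ, ∀ s < 0, ∀ (x : EuclideanSpace ℝ (Fin 3)) (R : ℝ), 0 < R →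
      ∫⁻ y in ball x R, ENNReal.ofReal ⟪curl (v s) y, (EuclideanSpace.single (2 : Fin 3) (1 : ℝ))⟫_ℝ
        ≤ ENNReal.ofReal (K * R) :=
    axisTwistDoor_filamentaryGrowth_proof C v π H hrate hcont hmild hdiv hsw hwg hI _ e3_ne_zero hnn
  refine ⟨⟨π, H, hsw, hwg, hI⟩, hK, TiltDominationLoc.NeckLength.neckLength C v π H hrate hcont hmild hdiv hsw hwg hI, ?_⟩
  intro δ K M hδ hK0 hM0
  by_contra hno
  push Not at hno
  -- then the profile IS tilt-dominated on the `δ`-collar, and `ScalingToUnit ∘ AveragedConeLiouville` makes the apex regular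
  have hcone : ∃ δ K M : ℝ, 0 < δ ∧ 0 ≤ K ∧ 0 ≤ M ∧ ∀ s : ℝ, -δ ^ 2 < s → s < 0 → ∀ r : ℝ, 0 < r → r < δ →
      ∀ z : ℝ, |z| < δ → ∫ θ in (0 : ℝ)..(2 * Real.pi), ‖curl (v s)
        (WithLp.toLp 2 ![r * Real.cos θ, r * Real.sin θ, z] : EuclideanSpace ℝ (Fin 3)) -
        ⟪curl (v s) (WithLp.toLp 2 ![r * Real.cos θ, r * Real.sin θ, z] : EuclideanSpace ℝ (Fin 3)),
          (EuclideanSpace.single (2 : Fin 3) (1 : ℝ))⟫_ℝ • (EuclideanSpace.single (2 : Fin 3) (1 : ℝ))‖ * r ≤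
        K * (∫ θ in (0 : ℝ)..(2 * Real.pi), ⟪curl (v s)
          (WithLp.toLp 2 ![r * Real.cos θ, r * Real.sin θ, z] : EuclideanSpace ℝ (Fin 3)),
          (EuclideanSpace.single (2 : Fin 3) (1 : ℝ))⟫_ℝ * r) + M * r :=
    ⟨δ, K, M, hδ, hK0, hM0, fun s hs1 hs2 r hr hrδ z hz => hno s r z hs1 hs2 hr hrδ hz⟩
  exact AxisTwistDoorScalingToUnit.scalingToUnit_proof
    AxisTwistDoorAveragedConeLiouvilleHolds.averagedConeLiouville_holds C v π H hrate hcont hmild hdiv hsw hwg hI hnn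
    hcone hsing

/-- **Dichotomy of the counterexample** (cores of the two walls): a Type-I mild one-signed backward-singular profile refutes either
`PoloidalRigidity` (if `ω₃ ≡ 0`) or `SingularIsPoloidal` (if `ω₃ ≢ 0`). -/
theorem counterexample_dichotomy (hrate : HasTypeITimeDecay C v)
    (hcont : ContinuousOn (uncurry v) (Iio (0 : ℝ) ×ˢ univ))
    (hmild : ∀ s t : ℝ, s < t → t < 0 → ∀ x,
      v t x = UnboundedOperators.heatExtension (v s) (t - s) x - oseenDuhamel 1 s v v t x)
    (hdiv : ∀ t < 0, VectorCalculus.IsDivFree (v t))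
    (hnn : ∀ s < 0, ∀ y, 0 ≤ ⟪curl (v s) y, (EuclideanSpace.single (2 : Fin 3) (1 : ℝ))⟫_ℝ)
    (hsing : IsBackwardSingularPoint v 0) :
    ¬ PoloidalRigidity ∨ ¬ SingularIsPoloidal := by
  by_cases hpol : ∀ s < 0, ∀ y, ⟪curl (v s) y, (EuclideanSpace.single (2 : Fin 3) (1 : ℝ))⟫_ℝ = 0
  · left
    intro hP
    exact poloidalRigidity_iff_typeI.1 hP C v hrate hcont hmild hdiv hpol hsing
  · right
    intro hS
    exact hpol (singularIsPoloidal_iff_core.1 hS C v hrate hcont hmild hdiv hnn hsing)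

end Summit.NavierStokesRegularity.NavierStokesRegularity.Theorems.AxisTwistDoorTiltDominationLocCounterexamplePortrait

end
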